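import Summits.QuantumFields.YangMills.Theorems.BalabanUVNodesN15CurvedCubeTransplantCovariant
import Summits.QuantumFields.YangMills.Theorems.BalabanUVNodesN15CurvedGluingCubeDressedGeneralGauge
import HarnessLib

/-!
# Route «BalabanUVNodes» (cluster K4 «SpineRates»), Track-A DAG node N15 = NE2, BACKGROUND LAYER — THE TRANSPLANT ROAD × PER-CUBE GAUGES: a cube operator computed on the CUBE TORUS in the
# cube's LOCAL gauge transplants AND conjugates to the global gauge in ONE identity; matrix-coefficient factors pass the transplant on BOTH sides

Cell `pub-ymgap`, seat `pub-ymgap-dag-n15-w2` (WIDTH SEAT 2∕3 on node N15, director-ym №197 ∕ HUMAN RULING D-0149), g4, third piece (own lineage: g3 = the transplant road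
`…CurvedCubeTransplantGradient∕Laplacian∕GradientTwoGrid∕Covariant`, g4 = per-cube gauges `…CurvedGluingCubeDressedGeneralGauge`).  `bears_on: R4∕N15 · K3⁷ SpineGivenEndpointR13SepCoPH
(stmt-QuantumFields-20544)`.  Filed `--kind proof --supports stmt-QuantumFields-20544 --as helper` — COUNT-NEUTRAL.  Theorems only, 0 `def`, 0 `sorry`.  Imports BY NAME g3 file 7
`…CurvedCubeTransplantCovariant` (`mmulOp_comp_transplant_liftMap`, `mem_iff_of_sat`; through it n15-w3 file 11 ∕ lit `B6Prop26ReachTransplant` `transplant`, `restrictOp`, `extendOp`,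
`transplant_apply`, `restrictOp_apply_of_injOn`, `restrictOp_apply_of_not_mem`) and g4 `…CurvedGluingCubeDressedGeneralGauge` (`hloc_defect_gaugeConj`, `hasMaj_gaugeConj_back`); nothing in
the tree is modified, no landed name re-declared.

WHY.  In [Balaban1984PropagatorsII] (2.90)–(2.93) p. 239 ∕ (2.133) p. 247 each cube's propagator is computed on its own small torus `T_□` and TRANSPLANTED to the big lattice through the
window `□̃³` (`transplant W e T′ = ε∘T′∘ρ`); in [Balaban1985BackgroundPropagators] (3.34)–(3.35) p. 396 it is moreover computed in the cube's own GAUGE `u_□`.  The knit on the torus of record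
therefore receives, per cube, an engine `X′` living on `T_□ × ι` in the local gauge, and needs `M_{Wᵀ}∘(εX′ρ)∘M_W` on the big carrier in the global gauge.  THIS FILE certifies that the two
operations commute — transplanting the conjugated engine IS conjugating the transplanted engine — as soon as the global per-cube gauge field agrees with the cube's along the chart on the
window (`W(x) = W′(e₁x)` for `x` in the window's base), and that matrix-coefficient factors pass the transplant on the RIGHT as well as on the left (g3 had the left factor only):
* §1 `restrictOp_liftMap_comp_mmulOp` (`ρ∘M_D = M_{D′}∘ρ`, injective fibre-saturated chart), ★ `transplant_comp_mmulOp` (`(εTρ)∘M_D = ε(T∘M_{D′})ρ`), ★ `mmulOp_comp_transplant_comp_mmulOp`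
  (two-sided: `M_C∘(εTρ)∘M_D = ε(M_{C′}∘T∘M_{D′})ρ`);
* §2 ★★ `transplant_gaugeConj_back` (`ε(M_{W′ᵀ}X′M_{W′})ρ = M_{Wᵀ}∘(εX′ρ)∘M_W`: LOCAL-gauge cube engines transplant to the inverse-conjugated global engine) and `transplant_gaugeConj` (the
  forward direction `ε(M_{W′}X′M_{W′ᵀ})ρ = M_W∘(εX′ρ)∘M_{Wᵀ}`);
* §3 ★★ `hloc_defect_transplant_of_localGauge`: an `hloc`-modulo-defect identity for the transplanted engine w.r.t. the big-torus operator IN THE LOCAL GAUGE (`Δ′ = M_W∘Δ∘M_{Wᵀ}`, e.g. the output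
  of g3 file 7 `mulOp_comp_covLapM_add_comp_transplant_of_hloc_defect` at the gauge-transformed transporters) becomes the identity for the transplanted LOCAL engine conjugated back, w.r.t. `Δ`
  (g4 `hloc_defect_gaugeConj` read backwards + §2); ★ `hasMaj_transplant_gaugeConj_back`: its rows (`×|ι|²`, g4 `hasMaj_gaugeConj_back`).

HONEST FRAMING ∕ LIMITS.  Finite-lattice support bookkeeping + conjugation algebra (identities; one crude `|ι|²` letter); nothing of [B6]∕[B9] asserted ((2.90)–(2.93), (2.133), (3.35),
(3.50) = SHAPES ∕ MECHANISM); the file does NOT produce the local gauges of (3.35), the window∕chart geometry (dag-n15-w5 `…TorusBoxCharts` supplies `hinj`∕`hsat`-type data on King's tori)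
nor any estimate.  NE2⁺ NOT PRINTED, NOT proved; N15 NOT discharged; K3⁷ OPEN, not claimed, skeleton v5 untouched; counts of record UNMOVED (typed 28∕28 · discharged 5∕27 · A 5∕28); no
summit statement is proved here; one finite 𝕋⁴ at fixed ε — NOT ℝ⁴ ∕ OS ∕ mass gap ∕ Clay; R4 closes the conditional finite-𝕋⁴ rung `BalabanLadder.UV` only.  Restate-immune (no Theses import).
-/

set_option autoImplicit false

noncomputable section
open scoped BigOperators Matrix

namespace Summit.QuantumFields.YangMills.BalabanUVNodes.N15.CurvedSpecies

open Literature.MathematicalPhysics.QuantumFieldTheory.Balaban1983to89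
open Literature.MathematicalPhysics.QuantumFieldTheory.Balaban1983to89.B11SectG (BlockNorm HasMaj)
open Literature.MathematicalPhysics.QuantumFieldTheory.Balaban1983to89.B6Prop26ReachTransplant (restrictOp extendOp transplant transplant_apply restrictOp_apply_of_injOn
  restrictOp_apply_of_not_mem)
open Literature.MathematicalPhysics.QuantumFieldTheory.Balaban1983to89.B6Prop26Gluing (mulOp mulOp_apply)
open Summit.QuantumFields.YangMills.BalabanUVNodes.N15.MatrixSpecies (mmulOp mmulOp_apply liftMap liftBlk)

variable {X X' ι : Type} [DecidableEq X] [DecidableEq X'] [DecidableEq ι] [Fintype ι]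
variable (W : Finset (X × ι)) (e₁ : X → X') (T : Module.End ℝ (X' × ι → ℝ))

/-! ## §1 Matrix coefficient factors pass the transplant on the right (and on both sides) -/

section Right

omit [DecidableEq X] in
/-- **THE RESTRICTION INTERTWINES MATRIX COEFFICIENTS**: injective, fibre-saturated chart and `D(x) = D′(e₁x)` on the window's base ⟹ `ρ∘M_D = M_{D′}∘ρ`.
[cite: Balaban1984PropagatorsII, (2.90)–(2.91) p.239 (shape); Balaban1985BackgroundPropagators, (3.50)–(3.52) p.400 (matrix coefficients: shape)] -/
theorem restrictOp_liftMap_comp_mmulOp (hinj : Set.InjOn (liftMap e₁ ι) ↑W) (hsat : ∀ x i j, (x, i) ∈ W → (x, j) ∈ W) {D : X → Matrix ι ι ℝ} {D' : X' → Matrix ι ι ℝ}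
    (hD : ∀ x i, (x, i) ∈ W → D x = D' (e₁ x)) :
    restrictOp W (liftMap e₁ ι) ∘ₗ mmulOp D = mmulOp D' ∘ₗ restrictOp W (liftMap e₁ ι) := by
  refine LinearMap.ext fun f => funext fun p' => ?_
  obtain ⟨x', i'⟩ := p'
  simp only [LinearMap.comp_apply, mmulOp_apply]
  by_cases himg : ∃ p ∈ W, liftMap e₁ ι p = (x', i')
  · obtain ⟨⟨x, i⟩, hxW, hxe⟩ := himg
    have hx' : e₁ x = x' := congrArg Prod.fst hxe
    have hi' : i = i' := congrArg Prod.snd hxe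
    subst hi'
    have h1 : restrictOp W (liftMap e₁ ι) (mmulOp D f) (x', i) = mmulOp D f (x, i) := by
      rw [← hxe]; exact restrictOp_apply_of_injOn hinj _ hxW
    rw [h1, mmulOp_apply, hD x i hxW, hx']
    refine Finset.sum_congr rfl fun j _ => ?_
    have hj : (x, j) ∈ W := hsat x i j hxW
    have h2 : restrictOp W (liftMap e₁ ι) f (x', j) = f (x, j) := by
      have := restrictOp_apply_of_injOn hinj f hj
      rwa [show liftMap e₁ ι (x, j) = (x', j) from Prod.ext hx' rfl] at this
    rw [h2]
  · simp only [not_exists, not_and] at himg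
    rw [restrictOp_apply_of_not_mem _ (fun p hp => himg p hp)]
    refine (Finset.sum_eq_zero fun j _ => ?_).symm
    rw [restrictOp_apply_of_not_mem _ (fun p hp hpe => ?_), mul_zero]
    obtain ⟨x, j'⟩ := p
    have hx' : e₁ x = x' := congrArg Prod.fst hpe
    have hj' : j' = j := congrArg Prod.snd hpe
    subst hj'
    exact himg (x, i') (hsat x j' i' hp) (Prod.ext hx' rfl)

/-- ★ **A MATRIX COEFFICIENT FACTOR PASSES THE TRANSPLANT ON THE RIGHT**: `(εTρ)∘M_D = ε(T∘M_{D′})ρ` (the twin of g3 `mmulOp_comp_transplant_liftMap`).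
[cite: Balaban1984PropagatorsII, (2.90)–(2.91) p.239 (shape); Balaban1985BackgroundPropagators, (3.50)–(3.52) p.400 (shape)] -/
theorem transplant_comp_mmulOp (hinj : Set.InjOn (liftMap e₁ ι) ↑W) (hsat : ∀ x i j, (x, i) ∈ W → (x, j) ∈ W) {D : X → Matrix ι ι ℝ} {D' : X' → Matrix ι ι ℝ}
    (hD : ∀ x i, (x, i) ∈ W → D x = D' (e₁ x)) :
    transplant W (liftMap e₁ ι) T ∘ₗ mmulOp D = transplant W (liftMap e₁ ι) (T ∘ₗ mmulOp D') := by
  unfold transplant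
  simp only [LinearMap.comp_assoc]
  rw [restrictOp_liftMap_comp_mmulOp W e₁ hinj hsat hD]

/-- ★ **TWO-SIDED**: `M_C∘(εTρ)∘M_D = ε(M_{C′}∘T∘M_{D′})ρ` for coefficient fields agreeing with the cube's along the chart on the window.
[cite: Balaban1984PropagatorsII, (2.90)–(2.91) p.239 (shape); Balaban1985BackgroundPropagators, (3.50)–(3.52) p.400 (shape)] -/
theorem mmulOp_comp_transplant_comp_mmulOp (hinj : Set.InjOn (liftMap e₁ ι) ↑W) (hsat : ∀ x i j, (x, i) ∈ W → (x, j) ∈ W) {C D : X → Matrix ι ι ℝ} {C' D' : X' → Matrix ι ι ℝ}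
    (hC : ∀ x i, (x, i) ∈ W → C x = C' (e₁ x)) (hD : ∀ x i, (x, i) ∈ W → D x = D' (e₁ x)) :
    mmulOp C ∘ₗ transplant W (liftMap e₁ ι) T ∘ₗ mmulOp D = transplant W (liftMap e₁ ι) (mmulOp C' ∘ₗ T ∘ₗ mmulOp D') := by
  rw [transplant_comp_mmulOp W e₁ T hinj hsat hD, mmulOp_comp_transplant_liftMap W e₁ _ hsat hC]

end Right

/-! ## §2 Transplanting the conjugated engine is conjugating the transplanted engine -/

section Gauge

variable (Wg : X → Matrix ι ι ℝ) (Wc : X' → Matrix ι ι ℝ)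

/-- ★★ **LOCAL-GAUGE CUBE ENGINES TRANSPLANT TO THE INVERSE-CONJUGATED GLOBAL ENGINE**: for a per-cube gauge field `W′` on the cube torus and the global field `W` agreeing with it along the
chart on the window (`W(x) = W′(e₁x)`), `ε(M_{W′ᵀ}∘X′∘M_{W′})ρ = M_{Wᵀ}∘(εX′ρ)∘M_W` — the direction local gauge → global gauge of g4 `hloc_defect_of_localGauge`.
[cite: Balaban1985BackgroundPropagators, (3.34)–(3.35) p.396; Balaban1984PropagatorsII, (2.133) p.247 (shapes)] -/
theorem transplant_gaugeConj_back (hinj : Set.InjOn (liftMap e₁ ι) ↑W) (hsat : ∀ x i j, (x, i) ∈ W → (x, j) ∈ W) (hWc : ∀ x i, (x, i) ∈ W → Wg x = Wc (e₁ x)) :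
    transplant W (liftMap e₁ ι) (mmulOp (fun x' => (Wc x')ᵀ) ∘ₗ T ∘ₗ mmulOp Wc) =
      mmulOp (fun x => (Wg x)ᵀ) ∘ₗ transplant W (liftMap e₁ ι) T ∘ₗ mmulOp Wg :=
  (mmulOp_comp_transplant_comp_mmulOp W e₁ T hinj hsat (C := fun x => (Wg x)ᵀ) (C' := fun x' => (Wc x')ᵀ) (fun x i h => by rw [hWc x i h]) hWc).symm

/-- ★ The forward direction: `ε(M_{W′}∘X′∘M_{W′ᵀ})ρ = M_W∘(εX′ρ)∘M_{Wᵀ}`. [cite: Balaban1985BackgroundPropagators, (3.34)–(3.35) p.396; Balaban1984PropagatorsII, (2.133) p.247 (shapes)] -/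
theorem transplant_gaugeConj (hinj : Set.InjOn (liftMap e₁ ι) ↑W) (hsat : ∀ x i j, (x, i) ∈ W → (x, j) ∈ W) (hWc : ∀ x i, (x, i) ∈ W → Wg x = Wc (e₁ x)) :
    transplant W (liftMap e₁ ι) (mmulOp Wc ∘ₗ T ∘ₗ mmulOp (fun x' => (Wc x')ᵀ)) =
      mmulOp Wg ∘ₗ transplant W (liftMap e₁ ι) T ∘ₗ mmulOp (fun x => (Wg x)ᵀ) :=
  (mmulOp_comp_transplant_comp_mmulOp W e₁ T hinj hsat (C := Wg) (C' := Wc) hWc (fun x i h => by rw [hWc x i h])).symm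

end Gauge

/-! ## §3 Consequences by name: `hloc` modulo a defect and rows of the transplanted local engine in the global gauge -/

section Consequences

variable (Wg : X → Matrix ι ι ℝ) (Wc : X' → Matrix ι ι ℝ)

/-- ★★ **`hloc` MODULO A DEFECT FOR THE TRANSPLANTED LOCAL ENGINE, IN THE GLOBAL GAUGE.**  If the transplanted engine `εX′ρ` satisfies, on the big carrier and IN THE LOCAL GAUGE (operator
`M_W∘Δ∘M_{Wᵀ}`, e.g. Bałaban's Laplacian at the gauge-transformed transporters by g0 `covLapM_trGaugeAct`, supplied behind the cut by g3 file 7), `M_χ∘(M_WΔM_{Wᵀ})∘(εX′ρ) = M_χ + E`, then the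
transplant of the engine conjugated back on the cube torus satisfies `M_χ∘Δ∘ε(M_{W′ᵀ}X′M_{W′})ρ = M_χ + M_{Wᵀ}EM_W` (`WWᵀ = WᵀW = 1`, `W = W′∘e₁` on the window).
[cite: Balaban1985BackgroundPropagators, (3.34)–(3.35) p.396, (3.65) p.403; Balaban1984PropagatorsII, (2.91) p.239, (2.133) p.247 (shapes ∕ mechanism)] -/
theorem hloc_defect_transplant_of_localGauge (hinj : Set.InjOn (liftMap e₁ ι) ↑W) (hsat : ∀ x i j, (x, i) ∈ W → (x, j) ∈ W) (hWc : ∀ x i, (x, i) ∈ W → Wg x = Wc (e₁ x))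
    (hW : ∀ x, Wg x * (Wg x)ᵀ = 1) (hW' : ∀ x, (Wg x)ᵀ * Wg x = 1) {χX : X → ℝ} {Δ E : (X × ι → ℝ) →ₗ[ℝ] (X × ι → ℝ)}
    (hloc : mulOp (fun p : X × ι => χX p.1) ∘ₗ (mmulOp Wg ∘ₗ Δ ∘ₗ mmulOp (fun x => (Wg x)ᵀ)) ∘ₗ transplant W (liftMap e₁ ι) T = mulOp (fun p : X × ι => χX p.1) + E) :
    mulOp (fun p : X × ι => χX p.1) ∘ₗ Δ ∘ₗ transplant W (liftMap e₁ ι) (mmulOp (fun x' => (Wc x')ᵀ) ∘ₗ T ∘ₗ mmulOp Wc) =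
      mulOp (fun p : X × ι => χX p.1) + mmulOp (fun x => (Wg x)ᵀ) ∘ₗ E ∘ₗ mmulOp Wg := by
  have hV : ∀ x, (Wg x)ᵀ * ((Wg x)ᵀ)ᵀ = 1 := fun x => by rw [Matrix.transpose_transpose]; exact hW' x
  have hV' : ∀ x, ((Wg x)ᵀ)ᵀ * (Wg x)ᵀ = 1 := fun x => by rw [Matrix.transpose_transpose]; exact hW x
  have h := hloc_defect_gaugeConj (fun x => (Wg x)ᵀ) hV hV' hloc
  simp only [Matrix.transpose_transpose] at h
  rw [transplant_gaugeConj_back W e₁ T Wg Wc hinj hsat hWc, ← transpose_gaugeConj_cancel Wg hW' Δ]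
  exact h

variable [Fintype X] {g : B6.Geometry} (blk : X → g.Site)

/-- ★ **ROWS OF THE TRANSPLANTED LOCAL ENGINE IN THE GLOBAL GAUGE** (`×|ι|²`): `εX′ρ ≤ K` (n15-w3 file 11 `hasMaj_transplant`: `1_{W}(y)1_W(y′)·K□`) ⟹ `ε(M_{W′ᵀ}X′M_{W′})ρ ≤ |ι|²·K`.
[cite: Balaban1984PropagatorsII, (2.133) p.247; Balaban1985BackgroundPropagators, (3.35) p.396, (3.42) p.397 (shapes)] -/
theorem hasMaj_transplant_gaugeConj_back (hinj : Set.InjOn (liftMap e₁ ι) ↑W) (hsat : ∀ x i j, (x, i) ∈ W → (x, j) ∈ W) (hWc : ∀ x i, (x, i) ∈ W → Wg x = Wc (e₁ x))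
    (hW : ∀ x, Wg x * (Wg x)ᵀ = 1) (hW' : ∀ x, (Wg x)ᵀ * Wg x = 1) {K : g.Site → g.Site → ℝ} (hK : ∀ y y', 0 ≤ K y y')
    (hT : HasMaj (BlockNorm.ofBlocks g (liftBlk blk ι)) (BlockNorm.ofBlocks g (liftBlk blk ι)) (transplant W (liftMap e₁ ι) T) K) :
    HasMaj (BlockNorm.ofBlocks g (liftBlk blk ι)) (BlockNorm.ofBlocks g (liftBlk blk ι)) (transplant W (liftMap e₁ ι) (mmulOp (fun x' => (Wc x')ᵀ) ∘ₗ T ∘ₗ mmulOp Wc))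
      (fun y y' => (Fintype.card ι : ℝ) ^ 2 * K y y') := by
  rw [transplant_gaugeConj_back W e₁ T Wg Wc hinj hsat hWc]
  exact hasMaj_gaugeConj_back blk Wg hW hW' hK hT

end Consequences

end Summit.QuantumFields.YangMills.BalabanUVNodes.N15.CurvedSpecies

end
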